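import Summits.HubbardSuperconductivity.HubbardSuperconductivity.Theorems.AnisotropyChordSpinMonotoneDefs

/-!
# Route `AnisotropyChord`: TANGENT POSITIVITY / FIDELITY SUPERMODULARITY (TPos-VT) — the theory seat's
# cycle-6 bilinear conjecture on the physical window `[0,1]`, TYPED, with proved links to (OM) and TP-VT
# (definitions; bears on `FerroSideChord` stmt-19089 via the `U_vt` / TM-VT ladder of `…SpinMonotoneDefs`)

Typing authority: THEORY seat `hubbard-h0-rotor-theory-1`, cycle 6, memo ROTOR-THEORY-6 §58 and
`Sketch6.lean` §FidelitySupermodular (PORT-SPEC P-5), restated over the tree's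
`xxzHamiltonian 1 G (−1) Δ` / `spinZSector` / `lowestEnergyInSector`.

* `IsSectorGroundState G Δ M ψ` — the hypothesis block "`ψ` is a normalised sector-`M` ground state of
  `H(Δ)`" used inline throughout `…SpinMonotoneDefs`, named (as in the theory seat's sketch).
* `VertexTransitiveFidelitySupermodular` (**CONJECTURE TPos-VT**, open): on a finite connected
  vertex-transitive graph, in every sector, the fidelity kernel `F(Δ,Δ') = |⟨ψ(Δ), ψ(Δ')⟩|` is
  SUPERMODULAR on `[0,1]²`: `F(Δ₀,Δ₃) + F(Δ₁,Δ₂) ≤ F(Δ₀,Δ₂) + F(Δ₁,Δ₃)` for `Δ₀ ≤ Δ₁`, `Δ₂ ≤ Δ₃`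
  (for the Perron–Frobenius representatives: `⟨ψ(Δ₁) − ψ(Δ₀), ψ(Δ₃) − ψ(Δ₂)⟩ ≥ 0`, "tangent
  positivity").  ED: 0 violations on `[0,1]` (grid 0.1; and on `[−0.3,1]`, grid 0.025) for `4×4` all
  `W ≤ 8`, `C₈`, `C₁₂`, Petersen, `K₄,₄`, anisotropic tori, prisms, cube and 533 circulant / named
  vertex-transitive cases; FAILS on `[−1,1]` at half filling below `Δ ≈ −0.9` — hence the window.
* `VertexTransitiveOverlapMonotone01`, `VertexTransitiveGroundStateGramTP2_01` — (OM) and TP-VT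
  restricted to `[0,1]` (`…_of_overlapMonotone`, `…_of_gramTP2`: the `[−1,1]` versions of
  `…SpinMonotoneDefs` imply them).
* PROVED LINKS (theory seat, ported): `fidSup_row`, `fidSup_col` (row/column monotonicity),
  `fidSup_tp2_separated`, `fidSup_tp2_interleaved`, and
  **`overlapMonotone01_of_fidelitySupermodular`** (TPos-VT ⇒ (OM) on `[0,1]`),
  **`gramTP2_01_of_fidelitySupermodular`** (TPos-VT ⇒ TP-VT on `[0,1]`, all six interleavings).

Nothing here claims TPos-VT.  No Mathlib notion is redefined; `IsSectorGroundState` merely names a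
conjunction of existing tree predicates.
-/

set_option linter.dupNamespace false

noncomputable section

namespace Summit.HubbardSuperconductivity.HubbardSuperconductivity.Theorems.AnisotropyChord

open Matrix Complex Finset
open Literature.MathematicalPhysics.QuantumLattice Literature.Probability.LatticeModels
open Literature.Combinatorics.SimpleGraph (IsVertexTransitive)

/-- `ψ` is a NORMALISED SECTOR GROUND STATE of `H(Δ) = xxzHamiltonian 1 G (−1) Δ` in the sector
`S^z_tot = M`: it lies in the sector, has unit norm, and is an eigenvector at the lowest sector energy
(the hypothesis block of `VertexTransitiveCondensateMonotone` & co., named; theory seat `Sketch6`).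
[folklore] -/
def IsSectorGroundState {V : Type} [Fintype V] [DecidableEq V] (G : SimpleGraph V) [DecidableRel G.Adj]
    (Δ M : ℝ) (ψ : TensorIndex V 2 → ℂ) : Prop :=
  ψ ∈ spinZSector (Λ := V) 1 M ∧ star ψ ⬝ᵥ ψ = 1 ∧
    xxzHamiltonian 1 G (-1) Δ *ᵥ ψ =
      ((lowestEnergyInSector 1 (xxzHamiltonian 1 G (-1) Δ) M : ℝ) : ℂ) • ψ

/-- Unfolding `IsSectorGroundState`. [folklore] -/
theorem isSectorGroundState_iff {V : Type} [Fintype V] [DecidableEq V] (G : SimpleGraph V)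
    [DecidableRel G.Adj] (Δ M : ℝ) (ψ : TensorIndex V 2 → ℂ) :
    IsSectorGroundState G Δ M ψ ↔
      ψ ∈ spinZSector (Λ := V) 1 M ∧ star ψ ⬝ᵥ ψ = 1 ∧
        xxzHamiltonian 1 G (-1) Δ *ᵥ ψ =
          ((lowestEnergyInSector 1 (xxzHamiltonian 1 G (-1) Δ) M : ℝ) : ℂ) • ψ := Iff.rfl

/-- **CONJECTURE TPos-VT** (`VertexTransitiveFidelitySupermodular` of the theory seat; phase-free
form of tangent positivity): on a finite connected vertex-transitive graph, for normalised sector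
ground states at anisotropies in `[0, 1]`, the fidelity kernel `F(Δ, Δ') = |⟨ψ(Δ), ψ(Δ')⟩|` is
SUPERMODULAR: `F(Δ₀,Δ₃) + F(Δ₁,Δ₂) ≤ F(Δ₀,Δ₂) + F(Δ₁,Δ₃)` for `Δ₀ ≤ Δ₁`, `Δ₂ ≤ Δ₃`.  OPEN; ED
census in the module docstring; FALSE on `[−1,1]` (half filling, `Δ ≲ −0.9`).
[conjecture: theory seat hubbard-h0-rotor-theory-1, cycle 6, 2026-08-27] -/
def VertexTransitiveFidelitySupermodular : Prop :=
  ∀ (V : Type) [Fintype V] [DecidableEq V] (G : SimpleGraph V) [DecidableRel G.Adj],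
    G.Connected → IsVertexTransitive G → ∀ (M Δ₀ Δ₁ Δ₂ Δ₃ : ℝ),
      0 ≤ Δ₀ → Δ₀ ≤ Δ₁ → Δ₁ ≤ 1 → 0 ≤ Δ₂ → Δ₂ ≤ Δ₃ → Δ₃ ≤ 1 →
      ∀ ψ₀ ψ₁ ψ₂ ψ₃ : TensorIndex V 2 → ℂ,
        IsSectorGroundState G Δ₀ M ψ₀ → IsSectorGroundState G Δ₁ M ψ₁ →
        IsSectorGroundState G Δ₂ M ψ₂ → IsSectorGroundState G Δ₃ M ψ₃ →
        ‖star ψ₀ ⬝ᵥ ψ₃‖ + ‖star ψ₁ ⬝ᵥ ψ₂‖ ≤ ‖star ψ₀ ⬝ᵥ ψ₂‖ + ‖star ψ₁ ⬝ᵥ ψ₃‖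

/-- **(OM) on the physical window `[0,1]`** (`VertexTransitiveOverlapMonotone01` of the theory seat):
`VertexTransitiveOverlapMonotone` with `0 ≤ Δ₁` in place of `−1 ≤ Δ₁`.
[conjecture: theory seat hubbard-h0-rotor-theory-1, cycle 6, 2026-08-27] -/
def VertexTransitiveOverlapMonotone01 : Prop :=
  ∀ (V : Type) [Fintype V] [DecidableEq V] (G : SimpleGraph V) [DecidableRel G.Adj],
    G.Connected → IsVertexTransitive G → ∀ (M Δ₁ Δ₁' Δ₂ : ℝ),
      0 ≤ Δ₁ → Δ₁ ≤ Δ₁' → Δ₁' ≤ Δ₂ → Δ₂ ≤ 1 →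
      ∀ ψ₁ ψ₁' φ : TensorIndex V 2 → ℂ,
        IsSectorGroundState G Δ₁ M ψ₁ → IsSectorGroundState G Δ₁' M ψ₁' →
        IsSectorGroundState G Δ₂ M φ →
        ‖star ψ₁ ⬝ᵥ φ‖ ≤ ‖star ψ₁' ⬝ᵥ φ‖

/-- **TP-VT on the physical window `[0,1]`** (`VertexTransitiveGroundStateGramTP2_01` of the theory
seat): `VertexTransitiveGroundStateGramTP2` with `0 ≤ Δ₁`, `0 ≤ Δ₃`.
[conjecture: theory seat hubbard-h0-rotor-theory-1, cycle 6, 2026-08-27] -/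
def VertexTransitiveGroundStateGramTP2_01 : Prop :=
  ∀ (V : Type) [Fintype V] [DecidableEq V] (G : SimpleGraph V) [DecidableRel G.Adj],
    G.Connected → IsVertexTransitive G → ∀ (M Δ₁ Δ₂ Δ₃ Δ₄ : ℝ),
      0 ≤ Δ₁ → Δ₁ ≤ Δ₂ → Δ₂ ≤ 1 → 0 ≤ Δ₃ → Δ₃ ≤ Δ₄ → Δ₄ ≤ 1 →
      ∀ ψ₁ ψ₂ ψ₃ ψ₄ : TensorIndex V 2 → ℂ,
        IsSectorGroundState G Δ₁ M ψ₁ → IsSectorGroundState G Δ₂ M ψ₂ →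
        IsSectorGroundState G Δ₃ M ψ₃ → IsSectorGroundState G Δ₄ M ψ₄ →
        ‖star ψ₁ ⬝ᵥ ψ₄‖ * ‖star ψ₂ ⬝ᵥ ψ₃‖ ≤ ‖star ψ₁ ⬝ᵥ ψ₃‖ * ‖star ψ₂ ⬝ᵥ ψ₄‖

/-! ### Links -/

/-- (OM) on `[−1,1]` ⇒ (OM) on `[0,1]`. [folklore] -/
theorem overlapMonotone01_of_overlapMonotone (h : VertexTransitiveOverlapMonotone) :
    VertexTransitiveOverlapMonotone01 := by
  intro V _ _ G _ hc hvt M Δ₁ Δ₁' Δ₂ h1 h2 h3 h4 ψ₁ ψ₁' φ g₁ g₁' gφ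
  exact h V G hc hvt M Δ₁ Δ₁' Δ₂ (by linarith) h2 h3 h4 ψ₁ ψ₁' φ g₁.1 g₁.2.1 g₁.2.2
    g₁'.1 g₁'.2.1 g₁'.2.2 gφ.1 gφ.2.1 gφ.2.2

/-- TP-VT on `[−1,1]` ⇒ TP-VT on `[0,1]`. [folklore] -/
theorem gramTP2_01_of_gramTP2 (h : VertexTransitiveGroundStateGramTP2) :
    VertexTransitiveGroundStateGramTP2_01 := by
  intro V _ _ G _ hc hvt M Δ₁ Δ₂ Δ₃ Δ₄ h1 h12 h2 h3 h34 h4 ψ₁ ψ₂ ψ₃ ψ₄ g₁ g₂ g₃ g₄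
  exact h V G hc hvt M Δ₁ Δ₂ Δ₃ Δ₄ (by linarith) h12 h2 (by linarith) h34 h4 ψ₁ ψ₂ ψ₃ ψ₄
    g₁.1 g₁.2.1 g₁.2.2 g₂.1 g₂.2.1 g₂.2.2 g₃.1 g₃.2.1 g₃.2.2 g₄.1 g₄.2.1 g₄.2.2

/-- Symmetry of the fidelity kernel: `|⟨ψ, φ⟩| = |⟨φ, ψ⟩|`. [folklore] -/
theorem norm_star_dotProduct_symm {n : Type} [Fintype n] (ψ φ : n → ℂ) :
    ‖star ψ ⬝ᵥ φ‖ = ‖star φ ⬝ᵥ ψ‖ := by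
  rw [Matrix.star_dotProduct, norm_star]

section FidelitySupermodular

variable (hS : VertexTransitiveFidelitySupermodular)
include hS

/-- Row monotonicity from supermodularity: `Δ_x ≤ Δ_y ≤ Δ_z` in `[0,1]` ⇒ `F(x,z) ≤ F(y,z)`
(rectangle rows `(x,y)`, columns `(y,z)`, diagonal `F(y,y) = 1`, Cauchy–Schwarz `F(x,y) ≤ 1`).
Theory seat `Sketch6` `fidSup_row`. [folklore] -/
theorem fidSup_row {V : Type} [Fintype V] [DecidableEq V] (G : SimpleGraph V) [DecidableRel G.Adj]
    (hc : G.Connected) (hvt : IsVertexTransitive G) (M : ℝ) {x y z : ℝ}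
    (h0 : 0 ≤ x) (hxy : x ≤ y) (hyz : y ≤ z) (hz : z ≤ 1) {ψx ψy ψz : TensorIndex V 2 → ℂ}
    (gx : IsSectorGroundState G x M ψx) (gy : IsSectorGroundState G y M ψy)
    (gz : IsSectorGroundState G z M ψz) : ‖star ψx ⬝ᵥ ψz‖ ≤ ‖star ψy ⬝ᵥ ψz‖ := by
  have key := hS V G hc hvt M x y y z h0 hxy (hyz.trans hz) (h0.trans hxy) hyz hz ψx ψy ψy ψz gx gy gy gz
  rw [gy.2.1, norm_one] at key
  have := norm_star_dotProduct_le_one_of_unit gx.2.1 gy.2.1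
  linarith

/-- Column monotonicity: `Δ_x ≤ Δ_y ≤ Δ_z` in `[0,1]` ⇒ `F(x,z) ≤ F(x,y)`. Theory seat `Sketch6`
`fidSup_col`. [folklore] -/
theorem fidSup_col {V : Type} [Fintype V] [DecidableEq V] (G : SimpleGraph V) [DecidableRel G.Adj]
    (hc : G.Connected) (hvt : IsVertexTransitive G) (M : ℝ) {x y z : ℝ}
    (h0 : 0 ≤ x) (hxy : x ≤ y) (hyz : y ≤ z) (hz : z ≤ 1) {ψx ψy ψz : TensorIndex V 2 → ℂ}
    (gx : IsSectorGroundState G x M ψx) (gy : IsSectorGroundState G y M ψy)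
    (gz : IsSectorGroundState G z M ψz) : ‖star ψx ⬝ᵥ ψz‖ ≤ ‖star ψx ⬝ᵥ ψy‖ := by
  have key := hS V G hc hvt M x y y z h0 hxy (hyz.trans hz) (h0.trans hxy) hyz hz ψx ψy ψy ψz gx gy gy gz
  rw [gy.2.1, norm_one] at key
  have := norm_star_dotProduct_le_one_of_unit gy.2.1 gz.2.1
  linarith

/-- Separated rectangles: `Δ_a ≤ Δ_b ≤ Δ_c ≤ Δ_d` in `[0,1]` ⇒ `F(a,d) F(b,c) ≤ F(a,c) F(b,d)`
(`F(a,c)F(b,d) − F(a,d)F(b,c) = s·F(a,c) + (F(a,c) − F(a,d))(F(b,c) − F(a,c))`, `s ≥ 0` the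
supermodularity defect). Theory seat `Sketch6` `fidSup_tp2_separated`. [folklore] -/
theorem fidSup_tp2_separated {V : Type} [Fintype V] [DecidableEq V] (G : SimpleGraph V)
    [DecidableRel G.Adj] (hc : G.Connected) (hvt : IsVertexTransitive G) (M : ℝ) {a b c d : ℝ}
    (h0 : 0 ≤ a) (hab : a ≤ b) (hbc : b ≤ c) (hcd : c ≤ d) (hd : d ≤ 1)
    {ψa ψb ψc ψd : TensorIndex V 2 → ℂ}
    (ga : IsSectorGroundState G a M ψa) (gb : IsSectorGroundState G b M ψb)
    (gc : IsSectorGroundState G c M ψc) (gd : IsSectorGroundState G d M ψd) :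
    ‖star ψa ⬝ᵥ ψd‖ * ‖star ψb ⬝ᵥ ψc‖ ≤ ‖star ψa ⬝ᵥ ψc‖ * ‖star ψb ⬝ᵥ ψd‖ := by
  have hs := hS V G hc hvt M a b c d h0 hab (hbc.trans (hcd.trans hd)) (h0.trans (hab.trans hbc)) hcd hd
    ψa ψb ψc ψd ga gb gc gd
  have h1 : ‖star ψa ⬝ᵥ ψd‖ ≤ ‖star ψa ⬝ᵥ ψc‖ :=
    fidSup_col hS G hc hvt M h0 (hab.trans hbc) hcd hd ga gc gd
  have h2 : ‖star ψa ⬝ᵥ ψc‖ ≤ ‖star ψb ⬝ᵥ ψc‖ :=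
    fidSup_row hS G hc hvt M h0 hab hbc (hcd.trans hd) ga gb gc
  nlinarith [mul_nonneg (sub_nonneg.2 hs) (norm_nonneg (star ψa ⬝ᵥ ψc)),
    mul_nonneg (sub_nonneg.2 h1) (sub_nonneg.2 h2)]

/-- The interleaved case `Δ_a ≤ Δ_c ≤ Δ_b ≤ Δ_d` in `[0,1]`: `F(a,d)F(b,c) ≤ F(a,c)F(b,d)` (two
separated rectangles with a repeated point and `F(b,c)² ≤ 1`). Theory seat `Sketch6`
`fidSup_tp2_interleaved`. [folklore] -/
theorem fidSup_tp2_interleaved {V : Type} [Fintype V] [DecidableEq V] (G : SimpleGraph V)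
    [DecidableRel G.Adj] (hc : G.Connected) (hvt : IsVertexTransitive G) (M : ℝ) {a b c d : ℝ}
    (h0 : 0 ≤ a) (hac : a ≤ c) (hcb : c ≤ b) (hbd : b ≤ d) (hd : d ≤ 1)
    {ψa ψb ψc ψd : TensorIndex V 2 → ℂ}
    (ga : IsSectorGroundState G a M ψa) (gb : IsSectorGroundState G b M ψb)
    (gc : IsSectorGroundState G c M ψc) (gd : IsSectorGroundState G d M ψd) :
    ‖star ψa ⬝ᵥ ψd‖ * ‖star ψb ⬝ᵥ ψc‖ ≤ ‖star ψa ⬝ᵥ ψc‖ * ‖star ψb ⬝ᵥ ψd‖ := by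
  have h1 := fidSup_tp2_separated hS G hc hvt M h0 hac le_rfl (hcb.trans hbd) hd ga gc gc gd
  rw [gc.2.1, norm_one, mul_one] at h1
  have h2 := fidSup_tp2_separated hS G hc hvt M (h0.trans hac) hcb le_rfl hbd hd gc gb gb gd
  rw [gb.2.1, norm_one, mul_one] at h2
  have hsym : ‖star ψc ⬝ᵥ ψb‖ = ‖star ψb ⬝ᵥ ψc‖ := norm_star_dotProduct_symm _ _
  rw [hsym] at h2
  have hbc1 : ‖star ψb ⬝ᵥ ψc‖ ≤ 1 := norm_star_dotProduct_le_one_of_unit gb.2.1 gc.2.1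
  have n1 := norm_nonneg (star ψa ⬝ᵥ ψc); have n2 := norm_nonneg (star ψb ⬝ᵥ ψd)
  have n3 := norm_nonneg (star ψb ⬝ᵥ ψc); have n4 := norm_nonneg (star ψc ⬝ᵥ ψd)
  have n5 := norm_nonneg (star ψa ⬝ᵥ ψd)
  calc ‖star ψa ⬝ᵥ ψd‖ * ‖star ψb ⬝ᵥ ψc‖
      ≤ (‖star ψa ⬝ᵥ ψc‖ * ‖star ψc ⬝ᵥ ψd‖) * ‖star ψb ⬝ᵥ ψc‖ := by gcongr
    _ ≤ (‖star ψa ⬝ᵥ ψc‖ * (‖star ψb ⬝ᵥ ψc‖ * ‖star ψb ⬝ᵥ ψd‖)) * ‖star ψb ⬝ᵥ ψc‖ := by gcongr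
    _ = (‖star ψa ⬝ᵥ ψc‖ * ‖star ψb ⬝ᵥ ψd‖) * (‖star ψb ⬝ᵥ ψc‖ * ‖star ψb ⬝ᵥ ψc‖) := by ring
    _ ≤ (‖star ψa ⬝ᵥ ψc‖ * ‖star ψb ⬝ᵥ ψd‖) * 1 := by
        apply mul_le_mul_of_nonneg_left _ (mul_nonneg n1 n2)
        nlinarith
    _ = ‖star ψa ⬝ᵥ ψc‖ * ‖star ψb ⬝ᵥ ψd‖ := mul_one _

omit hS in
/-- **TPos-VT ⇒ (OM) on `[0,1]`** (rows `(Δ₁, Δ₁')`, columns `(Δ₁', Δ₂)`). Theory seat `Sketch6`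
`overlapMonotone01_of_fidelitySupermodular`. [folklore] -/
theorem overlapMonotone01_of_fidelitySupermodular (hS : VertexTransitiveFidelitySupermodular) :
    VertexTransitiveOverlapMonotone01 := by
  intro V _ _ G _ hc hvt M Δ₁ Δ₁' Δ₂ h1 h2 h3 h4 ψ₁ ψ₁' φ g₁ g₁' gφ
  exact fidSup_row hS G hc hvt M h1 h2 h3 h4 g₁ g₁' gφ

omit hS in
/-- **TPos-VT ⇒ TP-VT on `[0,1]`**: supermodularity of the fidelity kernel (unit diagonal, values in
`[0,1]`) implies its TP₂ property for arbitrary row/column interval pairs, by a case analysis on the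
interleaving (separated / nested / interleaved). Theory seat `Sketch6`
`gramTP2_01_of_fidelitySupermodular`. [folklore] -/
theorem gramTP2_01_of_fidelitySupermodular (hS : VertexTransitiveFidelitySupermodular) :
    VertexTransitiveGroundStateGramTP2_01 := by
  intro V _ _ G _ hc hvt M Δ₁ Δ₂ Δ₃ Δ₄ h1 h12 h2 h3 h34 h4 ψ₁ ψ₂ ψ₃ ψ₄ g₁ g₂ g₃ g₄
  have s13 : ‖star ψ₁ ⬝ᵥ ψ₃‖ = ‖star ψ₃ ⬝ᵥ ψ₁‖ := norm_star_dotProduct_symm _ _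
  have s14 : ‖star ψ₁ ⬝ᵥ ψ₄‖ = ‖star ψ₄ ⬝ᵥ ψ₁‖ := norm_star_dotProduct_symm _ _
  have s23 : ‖star ψ₂ ⬝ᵥ ψ₃‖ = ‖star ψ₃ ⬝ᵥ ψ₂‖ := norm_star_dotProduct_symm _ _
  have s24 : ‖star ψ₂ ⬝ᵥ ψ₄‖ = ‖star ψ₄ ⬝ᵥ ψ₂‖ := norm_star_dotProduct_symm _ _
  rcases le_total Δ₂ Δ₃ with h23 | h32
  · exact fidSup_tp2_separated hS G hc hvt M h1 h12 h23 h34 h4 g₁ g₂ g₃ g₄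
  rcases le_total Δ₄ Δ₁ with h41 | h14
  · have := fidSup_tp2_separated hS G hc hvt M h3 h34 h41 h12 h2 g₃ g₄ g₁ g₂
    rw [← s23, ← s14, ← s13, ← s24] at this
    linarith [this]
  rcases le_total Δ₁ Δ₃ with h13 | h31
  · rcases le_total Δ₂ Δ₄ with h24 | h42
    · exact fidSup_tp2_interleaved hS G hc hvt M h1 h13 h32 h24 h4 g₁ g₂ g₃ g₄
    · have e1 : ‖star ψ₁ ⬝ᵥ ψ₄‖ ≤ ‖star ψ₁ ⬝ᵥ ψ₃‖ :=
        fidSup_col hS G hc hvt M h1 h13 h34 h4 g₁ g₃ g₄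
      have e2 : ‖star ψ₂ ⬝ᵥ ψ₃‖ ≤ ‖star ψ₂ ⬝ᵥ ψ₄‖ := by
        rw [s23, s24]; exact fidSup_row hS G hc hvt M h3 h34 h42 h2 g₃ g₄ g₂
      exact mul_le_mul e1 e2 (norm_nonneg _) (norm_nonneg _)
  · rcases le_total Δ₂ Δ₄ with h24 | h42
    · have e1 : ‖star ψ₁ ⬝ᵥ ψ₄‖ ≤ ‖star ψ₂ ⬝ᵥ ψ₄‖ :=
        fidSup_row hS G hc hvt M h1 h12 h24 h4 g₁ g₂ g₄
      have e2 : ‖star ψ₂ ⬝ᵥ ψ₃‖ ≤ ‖star ψ₁ ⬝ᵥ ψ₃‖ := by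
        rw [s23, s13]; exact fidSup_col hS G hc hvt M h3 h31 h12 h2 g₃ g₁ g₂
      calc ‖star ψ₁ ⬝ᵥ ψ₄‖ * ‖star ψ₂ ⬝ᵥ ψ₃‖ ≤ ‖star ψ₂ ⬝ᵥ ψ₄‖ * ‖star ψ₁ ⬝ᵥ ψ₃‖ :=
            mul_le_mul e1 e2 (norm_nonneg _) (norm_nonneg _)
        _ = ‖star ψ₁ ⬝ᵥ ψ₃‖ * ‖star ψ₂ ⬝ᵥ ψ₄‖ := mul_comm _ _
    · have := fidSup_tp2_interleaved hS G hc hvt M h3 h31 h14 h42 h2 g₃ g₄ g₁ g₂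
      rw [← s23, ← s14, ← s13, ← s24] at this
      linarith [this]

end FidelitySupermodular

end Summit.HubbardSuperconductivity.HubbardSuperconductivity.Theorems.AnisotropyChord
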